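import Summits.QuantumFields.Balaban3D.Proofs.Inputs
import Summits.QuantumFields.Balaban3D.Proofs.Bound46Std
import Summits.QuantumFields.Balaban3D.Proofs.LargeFieldStd

/-!
# Bałaban CMP 102 (1985), d = 3 lane — `Proofs.AlphaLargeField`: the INTERACTION and LARGE-FIELD residuals of `Proofs.Residuals` (rows
# B15 `bound46`, (46) p. 267; B25 `lf`, pp. 273–274) AT THE LANE'S TOWER `Inputs.towerOf 𝔎 X 𝔖`, REDUCED to seat p2's (α) inputs by
# APPLICATION of `Proofs.Bound46Std` / `Proofs.LargeFieldStd` (carriers frozen at p1 v1.3b) — the run slots that are arithmetic of the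
# lane's objects (`2 ≤ L`, `0 < M₁`, `0 < b₀`, `0 < p₀`, `R₁, r₀ ≥ 0`, the normalised
# family constants `C.g = 1`, `C.L = L`, `C.d = 6/log L`, the sign conditions of the Z-term constants) DISCHARGED here

Source: T. Bałaban, *Ultraviolet stability of three-dimensional lattice pure gauge field theories*, Commun. Math. Phys. **102** (1985)
255–275 [Balaban1985UV3] ([B10]; PDF page = journal page − 254): (43)–(46) pp. 266–267, (33)–(34) p. 264, (39)–(41) p. 266, (67)–(71)
pp. 273–274.  Lane `pub-balaban3d`, seat p3 (assembly; PLAN §0.5 E4, rulings R-DISP / R-44 / R-46N / R-LAMVOL / R-B25″; LEAF-LEDGER B15,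
B25); the leaves are seat p2's `Bound46Std.bound46_stdTowerInput` and `LargeFieldStd.lf_stdTowerInput`.

WHAT REMAINS AS HYPOTHESES after this file (the (α) END INPUTS of rows B15/B25, by class; LEAF-LEDGER §F):
* B15: the display (44) p. 267 on the previous-scale terms `oldVal` of the expansion data (`h44`, shared with row C10) and their degree
  floor «n ≥ 2» (`hfloor`); the NEWBORN slice of (46) `hnew` (= seat p6's theorem `newborn46_series` from the C5/C7 inputs, ruling
  R-46N — knitted in `UVStability3DInputs` when posted); the threshold `hγ46 : g_k ≤ γ₄₆` (discharged where `γ₀` is fixed);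
* B25: the displays `hLF67` ((67) ∘ the history's large-field characteristic function, on the lifted averaged minimizers) and `h68`
  ((68) on the lifted minimizers) about the external input `X.UkH` ([7]'s `U_k(·, h)`); the threshold `hγ71 : g_j ≤ γ₇₁`; the
  provisos NOT IN PRINT of LEAF-LEDGER E2 (`3r₀ + 2 ≤ 2p₀`, `8A·K_c³/(½log L) ≤ b₀²/(4N)`, `56 ≤ b₀²/(4N)` — GAP rows G-B10-02 / G-B10-10);
* constants: `hC46` (the record's `C46` = p2's closed form), `0 ≤ C`, `0 ≤ Cnew`, `0 ≤ B₃`/`0 < B₃`, `0 < κ₁`, `0 < C68`, `0 ≤ Cz + Cv`,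
  `0 ≤ C₅`, `0 ≤ C₆` — discharged where the record is DEFINED from the primitive constants (`Proofs.Primitives`).
HONEST FRAMING (PLAN §0): application bookkeeping; the inputs above are hypotheses; nothing of the paper is asserted.  No `sorry`.
-/

noncomputable section

namespace Summit.QuantumFields.Balaban3D.Proofs.AlphaLargeField

open scoped Matrix.Norms.L2Operator
open Literature.MathematicalPhysics.QuantumFieldTheory.Balaban1983to89
open Literature.MathematicalPhysics.QuantumFieldTheory.Balaban1983to89.B10
open Literature.MathematicalPhysics.QuantumFieldTheory.Balaban1983to89.B10SectCExpansion (Bound44)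
open Literature.MathematicalPhysics.QuantumFieldTheory.Balaban1985CMP102
open Literature.MathematicalPhysics.QuantumFieldTheory.Balaban1985CMP102.Setting
open Summit.QuantumFields.Balaban3D.Carriers
open Summit.QuantumFields.Balaban3D.Proofs.ScalesArithmetic
open Summit.QuantumFields.Balaban3D.Proofs.Constants
open Summit.QuantumFields.Balaban3D.Proofs.Thresholds (gammaOf gamma71L)
open Summit.QuantumFields.Balaban3D.Proofs.LiftBridge (liftCfg)
open Summit.QuantumFields.Balaban3D.Proofs.Run3SmallFactors (codeZ)
open Summit.QuantumFields.Balaban3D.Proofs.Inputs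
open B7Prop1Explicit (hol plaqWord)
open B7Prop1Local (pdevOn loK plaqHiK)
open B7Prop2Explicit (avgIter)

variable {L : ℕ} (𝔎 : LaneConsts L) {S : Scales L} {G : Type} [GaugeGroup G] [MeasurableSpace G] [HaarData G]
  {V : Type} [NormedAddCommGroup V] [NormedSpace ℂ V]
  (X : ExternalInputs S G) (𝔖 : ∀ k, StepSeries S G V (nblkOf S 𝔎.carrier k) k)

/-! ## B15 — `bound46` ((46) p. 267) -/

/-- **Row B15 AT THE LANE'S TOWER** — (46) p. 267 «|Σ_{j=1}^k Σ_{Y_j} 𝒫_j(Y_j, U_k)| ≤ O(1)M₁³(g_{k−1}²p(g_{k−1})²)|Λ_k|» for `Inputs.towerOf 𝔎 X 𝔖`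
with the record's `C46` — literally the `RunResiduals.bound46` field — from p2's `Bound46Std.bound46_stdTowerInput`: (α) inputs = the
display (44) on `oldVal` at every step (`h44`) with its degree floor (`hfloor`), the newborn slice `hnew` (p6's `newborn46_series`,
R-46N), the threshold `hγ46`; constants `hC46`, `0 ≤ C`, `0 ≤ Cnew`, `0 ≤ B₃`, `0 < κ₁`; the slots `0 < M₁`, `0 < b₀`, `0 < p₀` (record)
DISCHARGED (the volume comparison `#Λ_{k+1}(h) ≤ |Λ_{k+1}|` is p2's, via p1's `LamVol_succ_eq_card_lamFin`, R-LAMVOL). [cite: Balaban1985UV3, (44)–(46) p.267 + (33)–(34) p.264] -/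
theorem bound46_tower {κ₁ B₃ C Cnew : ℝ} (hC : 0 ≤ C) (hCnew : 0 ≤ Cnew) (hB : 0 ≤ B₃) (hκ₁ : 0 < κ₁)
    (hC46 : 𝔎.F.C46 = (2 * C * (8 * (L : ℝ) ^ 2 * B₃ *
        (2 / (κ₁ / 𝔎.carrier.M₁) * (24 * (48 / (κ₁ / 𝔎.carrier.M₁ / 2) ^ 3 * Real.exp (κ₁ / 𝔎.carrier.M₁ / 2 / 2) /
          (1 - Real.exp (-(κ₁ / 𝔎.carrier.M₁ / 2 / 2)))) * 1))) ^ 2 * ((L : ℝ) ^ 4 / ((L : ℝ) - 1)) + Cnew) *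
        ((𝔎.carrier.M₁ : ℝ)⁻¹) ^ 3)
    (h44 : ∀ k, k + 1 ≤ S.K → ∀ (h : Hist S.P (k + 1)) (U : GaugeField S.P (k + 1) G), ∀ j ∈ Finset.Icc 1 k,
      Bound44 (oldGeom S.P k j) (fun y n c => (𝔖 k).oldVal h U j y n c) κ₁ (𝔎.carrier.M₁ : ℝ) (ell S.P k j) (L : ℝ) B₃
        (S.gk k) (pFun 𝔎.carrier.b₀ 𝔎.carrier.p₀ (S.gk k)) C)
    (hfloor : ∀ k, k + 1 ≤ S.K → ∀ (h : Hist S.P (k + 1)) (U : GaugeField S.P (k + 1) G), ∀ j ∈ Finset.Icc 1 k,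
      ∀ (y : Site S.P j) (n : ℕ) (c : Fin n → PBond S.P j), (𝔖 k).oldVal h U j y n c ≠ 0 → 2 ≤ n)
    (hγ46 : ∀ k, k + 1 ≤ S.K → S.gk k ≤ gammaOf 𝔎.carrier.b₀ 𝔎.carrier.p₀ (1 / (2 * (8 * (L : ℝ) ^ 2 * B₃ *
        (2 / (κ₁ / 𝔎.carrier.M₁) * (24 * (48 / (κ₁ / 𝔎.carrier.M₁ / 2) ^ 3 * Real.exp (κ₁ / 𝔎.carrier.M₁ / 2 / 2) /
          (1 - Real.exp (-(κ₁ / 𝔎.carrier.M₁ / 2 / 2)))) * 1))))))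
    (hnew : ∀ k, k + 1 ≤ S.K → ∀ (h : Hist S.P (k + 1)) (U : GaugeField S.P (k + 1) G),
      |(𝔖 k).PY h U + (𝔖 k).PYZ h U| ≤
        Cnew * (S.gk k * pFun 𝔎.carrier.b₀ 𝔎.carrier.p₀ (S.gk k)) ^ 2 * (LamFin 𝔎.carrier.M₁ (rcolOf S 𝔎.carrier) k h).card) :
    ∀ k, 1 ≤ k → k ≤ (towerOf 𝔎 X 𝔖).K → ∀ (h : (towerOf 𝔎 X 𝔖).Hist k) (U : (towerOf 𝔎 X 𝔖).Cfg k),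
      |(towerOf 𝔎 X 𝔖).Pint k h U| ≤ 𝔎.consts.C46 * (towerOf 𝔎 X 𝔖).M₁ ^ 3
        * (((towerOf 𝔎 X 𝔖).g (k - 1)) ^ 2 * (pFun (towerOf 𝔎 X 𝔖).b₀ (towerOf 𝔎 X 𝔖).p₀ ((towerOf 𝔎 X 𝔖).g (k - 1))) ^ 2)
        * (towerOf 𝔎 X 𝔖).Λvol k h := by
  have h46 := Bound46Std.bound46_stdTowerInput X 𝔎.carrier 𝔖 hC hCnew hB hκ₁ 𝔎.F.M₁_pos 𝔎.F.b₀_pos 𝔎.F.p₀_pos h44 hfloor hγ46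
    hnew
  intro k hk1 hkK h U
  have h := h46 k hk1 hkK h U
  rw [show 𝔎.consts.C46 = 𝔎.F.C46 from rfl, hC46]
  exact h

/-! ## B25 — `lf` (pp. 273–274) -/

/-- **Row B25 AT THE LANE'S TOWER** — the large-field control of pp. 273–274 ((67)–(71) + [9] §3.C), literally the `RunResiduals.lf` field with
`d = 6/log L`, from p2's `LargeFieldStd.lf_stdTowerInput` at the group model `𝔊`: (α) inputs = `hLF67` ((67) ∘ the large-field
characteristic function of the history, on the `j`-fold averages of the lifted minimizers `X.UkH`), `h68` ((68) on the lifted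
minimizers), the threshold `hγ71 : g_j ≤ γ₇₁ᴸ(C68)`, the provisos NOT IN PRINT `hp`/`hb₁`/`hb₂` (E2); constants `0 < C68`, `0 ≤ Cz + Cv`,
`0 ≤ C₅`, `0 ≤ C₆`; the slots `C.d = 6/log L`, `C.L = L`, `C.g = 1` (normalised record), `2 ≤ L`, `0 < M₁`, `0 ≤ R₁`, `0 ≤ r₀`, `0 < b₀`,
`0 < p₀`, `c₁ = 3 ≥ 0` DISCHARGED. [cite: Balaban1985UV3, pp.273–274, (67)–(68) p.273, (39)–(41) p.266] -/
theorem lf_tower (𝔊 : GroupModel G) (hR₁ : 0 ≤ 𝔎.F.R₁) (hr₀ : 0 ≤ 𝔎.F.r₀) (hCz : 0 ≤ 𝔎.sc.Cz + 𝔎.sc.Cv) (h5 : 0 ≤ 𝔎.sc.C₅)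
    (h6 : 0 ≤ 𝔎.sc.C₆) {C68 : ℝ} (hC68 : 0 < C68)
    (hγ71 : ∀ j, j < S.K → S.gk j ≤ gamma71L C68 L 𝔎.carrier.b₀ 𝔎.carrier.p₀)
    (hLF67 : ∀ k, k ≤ S.K → ∀ (h : Hist S.P k), Hist.Admissible 𝔎.carrier.M₁ (rcolOf S 𝔎.carrier) k h →
      ∀ (U : GaugeField S.P k G), ∀ e ∈ Hist.disc h, S.gk e.1 * pFun 𝔎.carrier.b₀ 𝔎.carrier.p₀ (S.gk e.1) ≤
        ‖((hol (avgIter L (liftCfg 𝔊 (X.UkH k h U)) e.1) (codeZ e) (plaqWord e.2.2.1 e.2.2.2) :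
            (Matrix (Fin 𝔊.N) (Fin 𝔊.N) ℂ)ˣ) : Matrix (Fin 𝔊.N) (Fin 𝔊.N) ℂ) - 1‖)
    (h68 : ∀ k, k ≤ S.K → ∀ (h : Hist S.P k), Hist.Admissible 𝔎.carrier.M₁ (rcolOf S 𝔎.carrier) k h →
      ∀ (U : GaugeField S.P k G), ∀ e ∈ Hist.disc h,
        pdevOn (loK L e.1 (codeZ e)) (plaqHiK L e.1 (codeZ e) e.2.2.1 e.2.2.2) (liftCfg 𝔊 (X.UkH k h U)) <
          C68 * (S.gk e.1 * pFun 𝔎.carrier.b₀ 𝔎.carrier.p₀ (S.gk e.1)) * (((L : ℝ) ^ e.1)⁻¹) ^ 2)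
    (hp : 𝔎.carrier.r₀ * 3 + 2 ≤ 2 * 𝔎.carrier.p₀)
    (hb₁ : 8 * ((((𝔎.carrier.Cz + 𝔎.carrier.Cv) + 𝔎.carrier.C₅ + 𝔎.carrier.C₆ + (|𝔎.carrier.logσ₀| + 𝔎.carrier.dg) * 𝔎.carrier.c₁) *
      (2 * (2 * ((𝔎.carrier.R₁ + 1) * 𝔎.carrier.M₁) + 2 * ((L : ℝ) * (3 * ((𝔎.carrier.M₁ : ℝ) - 1)) + 3 * ((L : ℝ) - 1)) + 20) * 1) ^ 3 /
      (Real.log 𝔎.consts.L / 2))) ≤ 1 / (4 * (𝔊.N : ℝ)) * 𝔎.carrier.b₀ ^ 2)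
    (hb₂ : 56 ≤ 1 / (4 * (𝔊.N : ℝ)) * 𝔎.carrier.b₀ ^ 2) :
    ∀ k, k ≤ (towerOf 𝔎 X 𝔖).K → ∀ U : (towerOf 𝔎 X 𝔖).Cfg k,
      (towerOf 𝔎 X 𝔖).LF k U (fun h => -((towerOf 𝔎 X 𝔖).mainT k h U) + (towerOf 𝔎 X 𝔖).Zterm k h)
        ≤ Real.exp (𝔎.consts.d * (towerOf 𝔎 X 𝔖).sites k) :=
  LargeFieldStd.lf_stdTowerInput 𝔊 𝔎.consts (consts3_d_eq_log 𝔎.F 𝔎.sc) rfl rfl S.hL.2 X 𝔎.carrier 𝔖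
    𝔎.F.M₁_pos hR₁ hr₀ 𝔎.F.b₀_pos 𝔎.F.p₀_pos hCz h5 h6 (by show (0 : ℝ) ≤ 3; norm_num) hC68 hγ71 hLF67 h68 hp hb₁ hb₂

end Summit.QuantumFields.Balaban3D.Proofs.AlphaLargeField

end
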